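import Mathlib
import Summits.AnomalousDissipation.AnomalousDissipation.Theorems.SoloBlindT2Member

/-!
# (T2)₀ face: the λ = 0 landing member of the reduced third-order system R, assembled from a
# certified box family and two tail families (solo-blind, paper §24.82/§24.85, PLAN §92)

The λ → 0 limit of the inner landing family is governed by the third-order system
`α' = β, β' = (t + M) α, M' = −1 − (M + 8 (t + M) α β) / (2 α²)` (R; here `M = −(α²)'''` along
the flow), with the far field `α² = t⁴/24 + c₂ t² + (c₁ − 2) t + 2 t log(−t) + c₀ + O(1/t)`,
`M + t → 0` at `−∞` and Airy decay at `+∞`.  The canonical member has labels `(c₂, c₁) = (0, 0)`;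
its `c₀ =: Σ₀(0,0)` is the landing constant of theorem 24.A_w.  This file is the R-instance of the
abstract assembly `t2_assembly_of_match` (kernel #125): state space `Fin 3 → ℝ` (coordinates
`(α, β, M)`), FOUR weighted matching rows (three left rows against the far-field chart `ff(c₀)` —
the λ = 0 far field has no fast pair — and one right Robin row `β(b) + G α(b)` with a CONSTANT
coefficient `G`), left tail family parametrised by `c₀`, right tail family by `(α, M)(b)`.
With a constant `G` the right row determines `β(b)` outright, so no injectivity hypothesis is needed.

`r0_member`: a certified box family (K)₀ on a complete set `s` of weighted row values, a left tail
family (L)₀ with labels `(0, 0, c₀)`, a right tail family (R)₀ pinned by `(α, M)(b)` and decaying,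
and a contracting self-map `defect ∘ box` of `s` yield `r ∈ s` and a GLOBAL solution of R equal to
the certified box solution on `(a, b]` (inheriting every box-certified property `Qbox`: the
enclosures of `Σ₀`, of the state at `0`, the pin data), with labels `(0, 0, c₀(r))`, `c₀(r) ∈ I`,
`M + t → 0` at `−∞`, decaying at `+∞`, and with `α > 0` on `ℝ`.  All constants are parameters; the
hypotheses are what the interval certificates discharge ((K)₀ = r0arb.py uniform-rows Krawczyk,
(L)₀/(R)₀ = the tail lemmas of §24.85, contraction = the gain table).
-/

namespace Summit.AnomalousDissipation.AnomalousDissipation.Theorems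

open Set Filter Topology

section RSystem

/-- The reduced landing system R as a first-order field on `y = (α, β, M)`:
`α' = β`, `β' = (t + M) α`, `M' = −1 − (M + 8 (t + M) α β) / (2 α²)`. -/
noncomputable def rField (t : ℝ) (y : Fin 3 → ℝ) : Fin 3 → ℝ :=
  ![y 1, (t + y 2) * y 0, -1 - (y 2 + 8 * (t + y 2) * y 0 * y 1) / (2 * y 0 ^ 2)]

/-- The four WEIGHTED matching rows of the (T2)₀ box problem at the end states `Ya` (at `t = a`)
and `Yb` (at `t = b`): three left rows `(Y_k(a) − ff_k(c₀)) / w_k` against the far-field chart and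
the Robin row `(β(b) + G α(b)) / w₃` with a constant coefficient `G`. -/
noncomputable def matchRows0 (w : Fin 4 → ℝ) (ff : ℝ → Fin 3 → ℝ) (G : ℝ) (c₀ : ℝ)
    (Ya Yb : Fin 3 → ℝ) : Fin 4 → ℝ :=
  ![(Ya 0 - ff c₀ 0) / w 0, (Ya 1 - ff c₀ 1) / w 1, (Ya 2 - ff c₀ 2) / w 2,
    (Yb 1 + G * Yb 0) / w 3]

/-- Tail parameters read off the box solution with row value `r`: left `c₀(r)`; right `(α, M)(b)`. -/
def tailParams0 (b : ℝ) (c0 : (Fin 4 → ℝ) → ℝ) (yB : (Fin 4 → ℝ) → ℝ → Fin 3 → ℝ)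
    (r : Fin 4 → ℝ) : ℝ × (ℝ × ℝ) :=
  (c0 r, (yB r b 0, yB r b 2))

/-- The matching map of the (T2)₀ problem: the four weighted rows evaluated at the end states of the
TAILS with parameters `p` (left tail at `a`, right tail at `b`). -/
noncomputable def tailDefect0 (a b : ℝ) (w : Fin 4 → ℝ) (ff : ℝ → Fin 3 → ℝ) (G : ℝ)
    (yL : ℝ → ℝ → Fin 3 → ℝ) (yR : ℝ × ℝ → ℝ → Fin 3 → ℝ) (p : ℝ × (ℝ × ℝ)) : Fin 4 → ℝ :=
  matchRows0 w ff G p.1 (yL p.1 a) (yR p.2 b)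

/-- The left label functional `α² − t⁴/24 − 2 t log(−t) + 2 t` of a trajectory of R: it has a finite
limit at `−∞` iff the transseries labels are `(c₂, c₁) = (0, 0)`, and the limit is then `c₀`. -/
noncomputable def leftLabelFn0 (y : ℝ → Fin 3 → ℝ) (ξ : ℝ) : ℝ :=
  y ξ 0 ^ 2 - ξ ^ 4 / 24 - 2 * ξ * Real.log (-ξ) + 2 * ξ

/-- A closed box of row values in `Fin 4 → ℝ` is complete. -/
theorem rowBox0_isComplete (lo hi : Fin 4 → ℝ) : IsComplete (Icc lo hi) :=
  isClosed_Icc.isComplete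

/-- Row bookkeeping for (T2)₀: if the tails' rows equal the box's rows (same `c₀`, nonzero weights)
and the right tail is pinned to the box's `(α, M)` at `b`, then the end states coincide — the
constant-coefficient Robin row determines `β(b)`. -/
theorem endStates_match0 {w : Fin 4 → ℝ} (hw : ∀ k, w k ≠ 0) {ff : ℝ → Fin 3 → ℝ} {G c₀ : ℝ}
    {Ya Yb Za Zb : Fin 3 → ℝ}
    (hrows : matchRows0 w ff G c₀ Za Zb = matchRows0 w ff G c₀ Ya Yb)
    (hpinR : (Zb 0, Zb 2) = (Yb 0, Yb 2)) :
    Za = Ya ∧ Yb = Zb := by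
  have h0 := congrFun hrows 0
  have h1 := congrFun hrows 1
  have h2 := congrFun hrows 2
  have h3 := congrFun hrows 3
  simp only [matchRows0, Matrix.cons_val_zero, Matrix.cons_val_one, Matrix.cons_val]
    at h0 h1 h2 h3
  rw [div_left_inj' (hw _)] at h0 h1 h2 h3
  simp only [Prod.mk.injEq] at hpinR
  obtain ⟨e0, e2⟩ := hpinR
  have f0 : Za 0 = Ya 0 := by linarith
  have f1 : Za 1 = Ya 1 := by linarith
  have f2 : Za 2 = Ya 2 := by linarith
  have e1 : Zb 1 = Yb 1 := by
    rw [e0] at h3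
    linarith
  refine ⟨?_, ?_⟩
  · funext i
    fin_cases i
    · exact f0
    · exact f1
    · exact f2
  · funext i
    fin_cases i
    · exact e0.symm
    · exact e1.symm
    · exact e2.symm

/-- **(T2)₀ — the λ = 0 landing member from certified pieces.**
Data: matching points `a < b`, weights `w` (nonzero), far-field chart `ff`, constant Robin
coefficient `G`; a complete nonempty set `s` of weighted row values; the box family `yB r` with its
label `c0 r` ((K)₀); the left tail family `yL c₀` ((L)₀); the right tail family `yR (α, M)` ((R)₀);
a property `Qbox` certified for every box solution on `(a, b]`.  Conclusion: some row value `r ∈ s`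
(with `c0 r ∈ I`) is matched, and the assembled function is a global solution of R, equal to the
certified box solution on `(a, b]` (hence `Qbox`), with labels `(0, 0, c0 r)` and `M + t → 0` at
`−∞`, decaying at `+∞`, and with `α > 0` on `ℝ`. -/
theorem r0_member {a b : ℝ} (hab : a < b) {w : Fin 4 → ℝ} (hw : ∀ k, w k ≠ 0)
    (ff : ℝ → Fin 3 → ℝ) (G : ℝ)
    {s : Set (Fin 4 → ℝ)} (hs : IsComplete s) (hne : s.Nonempty)
    (c0 : (Fin 4 → ℝ) → ℝ) (I : Set ℝ) (yB : (Fin 4 → ℝ) → ℝ → Fin 3 → ℝ)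
    (yL : ℝ → ℝ → Fin 3 → ℝ) (yR : ℝ × ℝ → ℝ → Fin 3 → ℝ)
    (Qbox : ℝ → (Fin 3 → ℝ) → Prop) {K : NNReal}
    -- (K)₀ the certified box family
    (hB : ∀ r ∈ s, ∀ t, a ≤ t → t ≤ b → HasDerivAt (yB r) (rField t (yB r t)) t)
    (hBrows : ∀ r ∈ s, matchRows0 w ff G (c0 r) (yB r a) (yB r b) = r)
    (hBc0 : ∀ r ∈ s, c0 r ∈ I)
    (hBQ : ∀ r ∈ s, ∀ t, a < t → t ≤ b → Qbox t (yB r t))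
    (hBpos : ∀ r ∈ s, ∀ t, a ≤ t → t ≤ b → 0 < yB r t 0)
    -- (L)₀ the left tail family, parametrised by `c₀` = `(tailParams0 … r).1`
    (hL : ∀ r ∈ s, ∀ t ≤ a, HasDerivAt (yL (tailParams0 b c0 yB r).1)
      (rField t (yL (tailParams0 b c0 yB r).1 t)) t)
    (hLlab : ∀ r ∈ s, Tendsto (leftLabelFn0 (yL (tailParams0 b c0 yB r).1)) atBot (𝓝 (c0 r)))
    (hLM : ∀ r ∈ s, Tendsto (fun ξ => yL (tailParams0 b c0 yB r).1 ξ 2 + ξ) atBot (𝓝 0))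
    (hLpos : ∀ r ∈ s, ∀ t ≤ a, 0 < yL (tailParams0 b c0 yB r).1 t 0)
    -- (R)₀ the right tail family, parametrised by `(α, M)(b)` = `(tailParams0 … r).2`
    (hR : ∀ r ∈ s, ∀ t, b ≤ t → HasDerivAt (yR (tailParams0 b c0 yB r).2)
      (rField t (yR (tailParams0 b c0 yB r).2 t)) t)
    (hRpin : ∀ r ∈ s, (yR (tailParams0 b c0 yB r).2 b 0, yR (tailParams0 b c0 yB r).2 b 2) =
      (yB r b 0, yB r b 2))
    (hRdec : ∀ r ∈ s, Tendsto (yR (tailParams0 b c0 yB r).2) atTop (𝓝 0))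
    (hRpos : ∀ r ∈ s, ∀ t, b ≤ t → 0 < yR (tailParams0 b c0 yB r).2 t 0)
    -- the matching map is a contracting self-map of `s` (weighted rows)
    (hK : LipschitzOnWith K (tailDefect0 a b w ff G yL yR ∘ tailParams0 b c0 yB) s)
    (hmaps : MapsTo (tailDefect0 a b w ff G yL yR ∘ tailParams0 b c0 yB) s s)
    (hK1 : K < 1) :
    ∃ r ∈ s, c0 r ∈ I ∧ ∃ y : ℝ → Fin 3 → ℝ,
      (∀ t, HasDerivAt y (rField t (y t)) t) ∧
      Tendsto (leftLabelFn0 y) atBot (𝓝 (c0 r)) ∧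
      Tendsto (fun ξ => y ξ 2 + ξ) atBot (𝓝 0) ∧
      Tendsto y atTop (𝓝 0) ∧ (∀ t, 0 < y t 0) ∧
      (∀ t, a < t → t ≤ b → y t = yB r t) ∧ (∀ t, a < t → t ≤ b → Qbox t (y t)) := by
  set box := tailParams0 b c0 yB with hbox
  set defect := tailDefect0 a b w ff G yL yR with hdefect
  have hmatch : ∀ r ∈ s, defect (box r) = r →
      yL (box r).1 a = yB r a ∧ yB r b = yR (box r).2 b := by
    intro r hr hfix
    have hrows : matchRows0 w ff G (c0 r) (yL (box r).1 a) (yR (box r).2 b) =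
        matchRows0 w ff G (c0 r) (yB r a) (yB r b) := by
      have h1 : defect (box r) = matchRows0 w ff G (c0 r) (yL (box r).1 a) (yR (box r).2 b) := rfl
      rw [← h1, hfix, hBrows r hr]
    exact endStates_match0 hw hrows (hRpin r hr)
  obtain ⟨r, hr, -, hderiv, hleft, hboxeq, hright⟩ :=
    t2_assembly_of_match rField hab hs hne box defect hK hmaps hK1 yB
      (fun p => yL p.1) (fun p => yR p.2) hB hL hR hmatch
  refine ⟨r, hr, hBc0 r hr, assembledMember a b box yB (fun p => yL p.1) (fun p => yR p.2) r,
    hderiv, ?_, ?_, ?_, ?_, hboxeq, ?_⟩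
  · refine (hLlab r hr).congr' ?_
    filter_upwards [eventually_le_atBot a] with ξ hξ
    simp only [leftLabelFn0, hleft ξ hξ]
  · refine (hLM r hr).congr' ?_
    filter_upwards [eventually_le_atBot a] with ξ hξ
    rw [hleft ξ hξ]
  · refine (hRdec r hr).congr' ?_
    filter_upwards [eventually_gt_atTop b] with t ht
    exact (hright t ht).symm
  · intro t
    rcases le_or_gt t a with hta | hta
    · rw [hleft t hta]; exact hLpos r hr t hta
    rcases le_or_gt t b with htb | htb
    · rw [hboxeq t hta htb]; exact hBpos r hr t hta.le htb
    · rw [hright t htb]; exact hRpos r hr t htb.le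
  · intro t hat htb
    rw [hboxeq t hat htb]
    exact hBQ r hr t hat htb

/-- The R field is the formal λ → 0 reduction of the landing system in the sense used by the
certificate: along any state with `α ≠ 0`, the third component of `rField` is the unique value of
`M'` solving `−M = (α²)''' = 8 (t + M) α β + 2 α² (1 + M')` (the relation `λ³ M₂' = M + (α²)'''`
of `landingField` at `λ = 0`). -/
theorem rField_constraint (t : ℝ) (y : Fin 3 → ℝ) (hα : y 0 ≠ 0) :
    -(y 2) = 8 * (t + y 2) * y 0 * y 1 + 2 * y 0 ^ 2 * (1 + rField t y 2) := by
  have h2 : (2 : ℝ) * y 0 ^ 2 ≠ 0 := by positivity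
  simp only [rField, Matrix.cons_val_two, Matrix.tail_cons, Matrix.head_cons]
  field_simp
  ring

end RSystem

end Summit.AnomalousDissipation.AnomalousDissipation.Theorems
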